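import Summits.QuantumFields.YangMills.Theorems.BalabanUVNodesN12AtRecord13Prop1KnitThm1WindowDirectDatumScaleLettersDischargedAtLengthOfRegNameAndStepOfRecordTermPinnedChi

/-!
# BalabanUVNodes ∕ N12 — THE JUNCTION OF RECORD OF N12's ROAD **AT THE RE-CENTRED («Ax») RECORD**, BY NAME: the instance `χ := chiβOfRecord₁₃Ax Θ` of the χ-generic
# junction `…TermPinnedChi` (✓ this seat g36), stated over NODE 00's shipped Ax names `Θ.liveRepin₁₃Ax`, `gOfRecord₁₃Ax`, `EOfRecord₁₃Ax`, `betaOfRecord₁₃Ax`, `WOfRecord₁₃Ax`,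
# `ResidW.pinRPrime₁₃Ax`, `N0OfRecord₁₃Ax` (and `reprTOfRecord₁₃Chi … (chiβOfRecord₁₃Ax Θ)`, which has no Ax abbreviation) — WORK ORDER RC-1, director-ym №462 (B) ∕ №467 (D)

Cell `pub-ymgap` (HUMAN RULING D-0062), seat `pub-ymgap-dag-n12-d` g36 (R134 N12 [B15] s2 «knit at the record»).  Count-neutral helper of K1ᴬ `stmt-QuantumFields-27239`
(`StabilityBRunRowsAtRecordR13SepCoPHVAx`), `--kind proof --supports … --as helper`.  ONE THEOREM (0 `def`, 0 `instance`, 0 `sorry`): the statement of ✓p788383 («173ᴾ», the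
junction of record: (R) name + ONE-LENGTH STEP token at a generic guard and constants, the residual layer `λ` term-pinned) with every Record-13 object read AT THE RE-CENTRED CUT-OFF
— `θL := Θ.liveRepin₁₃Ax`, the history `gOfRecord₁₃Ax θL P`, the tower `reprTOfRecord₁₃Chi θL (chiβOfRecord₁₃Ax Θ) P`, the live-mass row over `EOfRecord₁₃Ax θL`, the β-sign box over
`betaOfRecord₁₃Ax θL`, the (1.100) pin `pinRPrime₁₃Ax`, `N₀ = N0OfRecord₁₃Ax`, the conclusion `B15Leaf (WOfRecord₁₃Ax θL λᴾ P)`; PROOF = the χ-generic junction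
`…TermPinnedChi.exists_constants_thresholds_radius_areg_pinLF_b15Leaf_WOfRec…` at `χ := chiβOfRecord₁₃Ax Θ` (all Ax names are
`abbrev`s of the χ-generic ones at that slot — [Ax-3a∕b], node00-def-Y's `liveRepin₁₃Ax`, this seat's `WOfRecord₁₃Ax` ∕ `pinRPrime₁₃Ax` ∕ `N0OfRecord₁₃Ax` — so the instance is definitional; `chiβOfRecord₁₃Ax (Θ.liveRepin₁₃Chi χ) = chiβOfRecord₁₃Ax Θ` is def-Y's `rfl`).
This is the by-name «Ax twin» of N12's junction the chair's rule (d) of ■ I.21428 speaks of; it changes no pointer and discharges nothing.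

HONEST FRAMING.  A definitional instance of a landed χ-generic composition; every displayed row of ✓p788383 stays displayed (now along the re-centred history): the (R) name `h15` +
THE ONE-LENGTH STEP TOKEN `hstep` (OPEN, N07), `Adm`'s rows, NODE 00's `hres` ∕ live-mass, 12P's rows, the U4 ∕ window ∕ numerics ∕ threshold rows; nothing of Bałaban asserted;
NOT a discharge of N12 (old or new record); K0ᴬ ∕ K1ᴬ ∕ K3ᴬ OPEN; counts unmoved; one finite 𝕋⁴ programme at fixed `ε = L^{-K}` — NOT continuum ∕ ℝ⁴ ∕ OS; NOT the Yang–Mills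
mass gap (Clay).
Sources (bookkeeping only): [Balaban1989LargeFieldI] (0.2)–(0.6) p.176, Prop. 1 (1.78) p.194, (1.80) p.195, (1.89) p.198, (1.99)–(1.102) pp.200–201; [Balaban1985Variational] Thm 1 (8)
p.279, Prop. 2 p.281, Prop. 9 (190) p.309; [Balaban1988Convergent] (2.8) p.256, (3.22)–(3.25) pp.269–270; [Balaban1987RG1] (2.9) p.266, p.265 (2.3) (the block-axial centre).
-/

noncomputable section

open scoped BigOperators ENNReal
open MeasureTheory
open scoped Matrix.Norms.L2Operator
open MeasureTheory Set Finset Metric Filter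
open scoped Matrix.Norms.L2Operator BigOperators Matrix RealInnerProductSpace Real InnerProductSpace Topology

namespace Summit.QuantumFields.YangMills.BalabanUVNodes.N12AtRecord13Prop1KnitThm1WindowDirectDatumScaleLettersDischargedAtLengthOfRegNameAndStepOfRecordTermPinnedAx

open Literature.MathematicalPhysics.QuantumFieldTheory.Balaban1983to89.B15DeterminingSetsB
open Literature.MathematicalPhysics.QuantumFieldTheory.Balaban1983to89
open Literature.MathematicalPhysics.QuantumFieldTheory.Balaban1983to89.T4Continuum (T4Family LStep Letter walk walkEnd netDisp holAt)
open Literature.MathematicalPhysics.QuantumFieldTheory.Balaban1983to89.DagBinding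
open Literature.MathematicalPhysics.QuantumFieldTheory.Balaban1983to89.Node00
open FlowStep (prefixOf BetaLowerH BetaUpperH)
open B15Claim189Assembly (new189 chiPP dom half)
open B15 (Prop1Printed Ineq180)
open B15.BasicStep (Claim189)
open B8Eq17ClassAkV1 (plaqsOf)
open B14.Eq216Concrete (inputs feeds)
open GaugeGroup (dist1)
open GaugeField (plaqHol gaugeAct)
open B15RPrime1100OfRep (rPrimeDataOfSel)
open T4CubeChartGnomonic (SU2)
open B15Prop1ChartSU2 (su2Chart)
open B15Prop1SliceCoordinates (GaugeSlice ιA)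
open T4AxialGaugeSmallField (castSite boxPlaqs boxBonds)
open B6BondElimination (unitVec)
open B6TreeGaugePoincare (curl)
open B16Eq18Proof (box)
open B15Extension193 (extend)
open B15ShellGauge193 (shellGauge)
open B15Sect1Instances (fun177stdB)
open B14.Eq213DetSet (Bj maxDomT)
open B14.Eq213MaximalDomains (side)
open B14.Eq22Determines (blockIter IsBlockUnion)
open Literature.MathematicalPhysics.QuantumFieldTheory.BalabanImbrieJaffe1984to88.BIJ85Eq453GaugeField (qsstarGIter0)
open B16Sect1Backgrounds (expMul toMS)
open B15DeterminingSets (pts DetBackground genSet IsMinimizer MSField avgFamily bondsOf DetSet embIter AgreeOn)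
open B5Eq118OneStroke (iterBlockOf)
open Literature.MathematicalPhysics.QuantumFieldTheory.Balaban1983to89.Node00 (coeField constrEnumB)
open B15Eq112TorusCover (lift)
open ExpMeanLog (deltaSU)
open B15Prop1Carrier (lfVarOn InstOn InstOn.std InstOn.stdB plaqsInside)
open Summit.QuantumFields.YangMills.BalabanUVNodes.N12AtRecord13Prop1KnitThm1WindowDirectDatumScaleLettersDischargedAtLengthOfRegNameAndStepOfRecord (thm1LetterT_atLength_pTop_of_variationalThm1RegSepCoP7MGB_lamTop)
open B15Claim189Assembly (Setting189)
open B14DomainGeom (Pt)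
open B15.PrelimIntegrations (Ineq191 Ineq195)
open B15Chi124DetSets (E124)
open B15Claim189PrintedConditions (omegaOfChain)
open B15Claim189PinsOfHistory (N0OfRecord₁₃)
open B15Claim189LambdaPin (enlD)
open Summit.QuantumFields.YangMills.BalabanUVNodes.N12MinimiserFamilyKnitRowThm1LettersAtLengthOnZOfRecordBR (exists_R_hMinRow_of_thm1LettersAtLength_alongOrbit_onZ_ofRecord)
open Summit.QuantumFields.YangMills.BalabanUVNodes.N12Thm1LettersAtLengthOfK0GridGB (thm1LetterT_atLength_of_variationalThm1RegSepCoP7MGB)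
open B15Prop1NumericsThresholds (plaqSmallOn_of_le)
open B15Prop1MinimiserClassAtDatumScaleAtLengthB (isMinimizerB_withEps_base_of_thm1AtLength isMinimizerB_withEps_of_norm_lt_atLength lamBondsSeq_congr)
open Summit.QuantumFields.YangMills.BalabanUVNodes.N12DirectChartPackageOfClassRowL1FamilyB (exists_hWD_chartHalf_of_class_uniform_rowl1_family)
open Summit.QuantumFields.YangMills.BalabanUVNodes.N12Prop1DirectOfClassOnlyRowL1UniformBLam (exists_rowPreimageProxiesLetter_family_uniformB_lamBondsSeq)
open Summit.QuantumFields.YangMills.BalabanUVNodes.N12Prop1DirectOfClassOnlyB (exists_curvatureLetters_family)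
open Summit.QuantumFields.YangMills.BalabanUVNodes.N12MinimiserFamilyKnitRowThm1Letters (boxRow3_of_boxRow5)
open T4AdjointCovarianceUnitary (lieSU)
open B15Prop1GradientFromNearValueAtCoPRecord (far_letter_of_box)
open B15Prop1AnalyticExtClause (cplxVec anExt)
open B15Prop1ChartCalculusSU2 (E3)
open B15Sect1Instances (lamDatumP)
open B11Thm1ExistsUniqueTokensGB (VariationalThm1EUSepCoP7MGB VariationalThm1EUStepCoP7MGB)
open B11Thm1ExistsUniqueInductionG (truncSeq)
open Summit.QuantumFields.YangMills.BalabanUVNodes.N12EUStepTokensAtRealisedDataLam (variationalThm1EUSepCoP7MGB_realised_of_step_of_reg_lamTop)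
open Summit.QuantumFields.YangMills.BalabanUVNodes.N12Thm1LettersAtLengthOfK0GridGB (blockSat_torusClassSeq)
open Summit.QuantumFields.YangMills.BalabanUVNodes.N12Thm1LettersAtLengthOfK0GridGB (thm1LetterEU_atLength_of_variationalThm1EUSepCoP7MGB)
open Summit.QuantumFields.YangMills.BalabanUVNodes.N12AtRecord13Prop1KnitThm1WindowDirectOfClassOnlyRowL1NearRadiusDatumScaleAtLengthOfRecordBTermPinnedChi (exists_areg_pinLF_b15Leaf_WOfRecord₁₃_pinAllΛΩχZ_N0_liveRepin₁₃_of_massLive_of_hasResiduals_of_flow_of_betaLowerH_of_thm1AtLength_atZSeqCoPRecord_windowDirectOfClassOnlyRowL1NearRadiusDatumScale)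
open B15Claim189PinsOfHistory (N0OfRecord₁₃Chi N0OfRecord₁₃Ax)

open Summit.QuantumFields.YangMills.BalabanUVNodes.N12AtRecord13Prop1KnitThm1WindowDirectDatumScaleLettersDischargedAtLengthOfRegNameAndStepOfRecordTermPinnedChi
  (exists_constants_thresholds_radius_areg_pinLF_b15Leaf_WOfRecord₁₃_pinAllΛΩχZ_N0_liveRepin₁₃_windowDirectDatumScale_lettersDischargedAtLength_termPinned_ofRegNameGB_ofStepGB)

section
variable {F : T4Family}

/-- ★★★★★ **N12's JUNCTION OF RECORD AT THE RE-CENTRED RECORD** — ✓p788383's statement with `Θ.liveRepin₁₃ ↦ Θ.liveRepin₁₃Ax`, `gOfRecord₁₃ ↦ gOfRecord₁₃Ax`,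
`EOfRecord₁₃ ↦ EOfRecord₁₃Ax`, `betaOfRecord₁₃ ↦ betaOfRecord₁₃Ax`, `WOfRecord₁₃ ↦ WOfRecord₁₃Ax`, `pinRPrime₁₃ ↦ pinRPrime₁₃Ax`, `N0OfRecord₁₃ ↦ N0OfRecord₁₃Ax`,
`reprTOfRecord₁₃ θ ↦ reprTOfRecord₁₃Chi θ (chiβOfRecord₁₃Ax Θ)`; proof: the χ-generic junction at `χ := chiβOfRecord₁₃Ax Θ`, definitionally.  Count-neutral; CONDITIONAL on the
displayed rows; NOT a discharge of N12.
[cite: Balaban1989LargeFieldI, (0.2)–(0.6) p.176, Prop. 1 (1.77)–(1.78) p.194, (1.80) p.195, (1.89) p.198, (1.99)–(1.102) pp.200–201; Balaban1985Variational, Thm 1 (8) p.279, Prop. 2 p.281, Prop. 9 (190) p.309; Balaban1988Convergent, (2.8) p.256, (3.22)–(3.25) pp.269–270; Balaban1987RG1, (2.9) p.266] -/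
theorem exists_constants_thresholds_radius_areg_pinLF_b15Leaf_WOfRecord₁₃_pinAllΛΩχZ_N0_liveRepin₁₃_windowDirectDatumScale_lettersDischargedAtLength_termPinned_ofRegNameGB_ofStepGB_ax
    (hd3 : ∀ P : B12.RunParams, 3 ≤ (F.P P.K).d)
    (h0 : ∀ P : B12.RunParams, 0 < (F.P P.K).d)
    (ι : B12.RunParams → Type)
    {B₃ a₀ a₁' : ℝ}
    (Z Λ : ∀ P : B12.RunParams, ι P → Set (Site (F.P P.K) 0))
    (k : ∀ P : B12.RunParams, ι P → ℕ)
    (M : ∀ P : B12.RunParams, ι P → ℝ)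
    (hk0 : ∀ (P : B12.RunParams) (i : ι P), 0 < k P i)
    (hk1 : ∀ (P : B12.RunParams) (i : ι P), k P i + 1 ≤ (F.P P.K).m + (F.P P.K).K)
    (T : ∀ (P : B12.RunParams) (i : ι P), Finset (PBond (F.P P.K) (k P i)))
    (lo hi : ∀ P : B12.RunParams, ι P → Fin (F.P P.K).d → ℤ)
    (n : ∀ P : B12.RunParams, ι P → ℕ)
    (hn : ∀ (P : B12.RunParams) (i : ι P) κ, hi P i κ ≤ lo P i κ + n P i)
    (hN : ∀ (P : B12.RunParams) (i : ι P), n P i + 2 < (F.P P.K).sitesPerDir (k P i))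
    (hbox : ∀ (P : B12.RunParams) (i : ι P), pts (k P i) (Λ P i) = (castSite '' Set.Icc (lo P i) (hi P i) : Set (Site (F.P P.K) (k P i))))
    (hZ : ∀ (P : B12.RunParams) (i : ι P), (boxPlaqs (lo P i - 1) (hi P i + 1) : Set (Plaq (F.P P.K) (k P i))) ⊆ plaqsInside (pts (k P i) (Z P i)))
    (hTG0 : ∀ (P : B12.RunParams) (i : ι P), T P i = (box (fun κ => (hi P i κ - lo P i κ + 1).toNat) (lo P i)).image fun x =>
      (⟨castSite (x - unitVec ⟨0, h0 P⟩), ⟨0, h0 P⟩⟩ : PBond (F.P P.K) (k P i)))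
    (hN5 : ∀ (P : B12.RunParams) (i : ι P) κ, ((hi P i κ - lo P i κ + 1).toNat : ℤ) + 5 < (F.P P.K).sitesPerDir (k P i))
    (Kb : ∀ P : B12.RunParams, ι P → ℕ)
    (hK1 : ∀ (P : B12.RunParams) (i : ι P), 1 ≤ Kb P i)
    (hKn : ∀ (P : B12.RunParams) (i : ι P) κ, (hi P i κ - lo P i κ + 1).toNat ≤ Kb P i)
    (ext : ∀ (P : B12.RunParams) (i : ι P), GaugeField (F.P P.K) (k P i) SU2 → GaugeField (F.P P.K) (k P i) SU2)
    (hext : ∀ (P : B12.RunParams) (i : ι P) Vk, ext P i Vk = extend (pts (k P i) (Λ P i)) (shellGauge Vk (lo P i) (hi P i)) Vk)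
    (hlohi : ∀ (P : B12.RunParams) (i : ι P), lo P i ≤ hi P i)
    (LO HI : ∀ P : B12.RunParams, ι P → Fin (F.P P.K).d → ℤ)
    (hLO : ∀ (P : B12.RunParams) (i : ι P), LO P i ≤ lo P i - 1)
    (hHI : ∀ (P : B12.RunParams) (i : ι P), hi P i + 1 ≤ HI P i)
    (n' : ∀ P : B12.RunParams, ι P → ℕ)
    (hn' : ∀ (P : B12.RunParams) (i : ι P) κ, HI P i κ ≤ LO P i κ + n' P i)
    (hn'N : ∀ (P : B12.RunParams) (i : ι P), n' P i < (F.P P.K).sitesPerDir (k P i))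
    (hR' : ∀ (P : B12.RunParams) (i : ι P), (boxPlaqs (LO P i) (HI P i) : Set (Plaq (F.P P.K) (k P i))) ⊆ plaqsInside (pts (k P i) (Z P i)))
    {γ₈ bx : B12.RunParams → ℝ}
    (hγ : ∀ P : B12.RunParams, 0 < γ₈ P)
    (hbx : ∀ P : B12.RunParams, 0 ≤ bx P)
    (hbxM : ∀ (P : B12.RunParams) (i : ι P), 12 * ((F.P P.K).d : ℝ) * ((n P i : ℝ) + 2) ^ 2 ≤ bx P * (M P i) ^ 2)
    (hM : ∀ (P : B12.RunParams) (i : ι P), 1 ≤ (M P i))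
    (W : ∀ P : B12.RunParams, ι P → Finset (Plaq (F.P P.K) 0))
    (hWbox : ∀ (P : B12.RunParams) (i : ι P), ∀ q : Plaq (F.P P.K) 0, q.src ∈ ((box (fun κ => (F.P P.K).L ^ (k P i) * ((hi P i κ - lo P i κ + 1).toNat + 3 + 1) - 1) (fun κ => ((F.P P.K).L : ℤ) ^ (k P i) * (lo P i κ - 2))).image
        (fun z => (castSite z : Site (F.P P.K) 0))) → q ∈ W P i)
    (c : ∀ P : B12.RunParams, ι P → ℕ)
    (hkc : ∀ (P : B12.RunParams) (i : ι P), k P i + c P i ≤ (F.P P.K).m + (F.P P.K).K)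
    (hc : ∀ (P : B12.RunParams) (i : ι P), 4 * (F.P P.K).d + (3 * ((F.P P.K).d * (((F.P P.K).L - 1) / 2)) + 5) + 3 < 2 * (F.P P.K).L ^ c P i)
    (X : ∀ P : B12.RunParams, ι P → Set (Site (F.P P.K) 0))
    (D₀ : ∀ P : B12.RunParams, ι P → ℕ)
    (hBox : ∀ (P : B12.RunParams) (i : ι P), ∀ x ∈ X P i, ∀ w : List (Letter (F.P P.K).d),
      w.length ≤ (∑ i' ∈ Finset.range (k P i + 1), ((F.P P.K).d * (((F.P P.K).L ^ i' - 1) / 2) + 1)) + (3 * ((F.P P.K).d * (((F.P P.K).L - 1) / 2)) + 5) * (F.P P.K).L ^ k P i + (F.P P.K).L ^ k P i →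
      ∀ μ : Fin (F.P P.K).d, (⟨B14.Eq22Determines.blockIter (k P i) (walkEnd x w), μ⟩ : PBond (F.P P.K) (k P i)) ∈ (boxBonds (LO P i) (HI P i) : Set (PBond (F.P P.K) (k P i))))
    (hWX : ∀ (P : B12.RunParams) (i : ι P), ∀ p ∈ W P i, p.src ∈ X P i ∧ p.src.shift p.μ ∈ X P i ∧ p.src.shift p.ν ∈ X P i ∧ (p.src.shift p.μ).shift p.ν ∈ X P i ∧ (p.src.shift p.ν).shift p.μ ∈ X P i)
    (hfeedsX : ∀ (P : B12.RunParams) (i : ι P) (ν' : Fin (F.P P.K).d), ∀ z ∈ box (fun κ => (hi P i κ - lo P i κ + 1).toNat + 3) (fun κ => lo P i κ - 2), ∀ b₀ : PBond (F.P P.K) 0,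
      (b₀ ∈ feeds (k P i) (⟨(castSite z : Site (F.P P.K) (k P i)), ⟨0, h0 P⟩⟩ : PBond (F.P P.K) (k P i)) ∨
        b₀ ∈ feeds (k P i) (⟨((castSite z : Site (F.P P.K) (k P i))).shift ⟨0, h0 P⟩, ν'⟩ : PBond (F.P P.K) (k P i)) ∨
        b₀ ∈ feeds (k P i) (⟨((castSite z : Site (F.P P.K) (k P i))).shift ν', ⟨0, h0 P⟩⟩ : PBond (F.P P.K) (k P i)) ∨
        b₀ ∈ feeds (k P i) (⟨(castSite z : Site (F.P P.K) (k P i)), ν'⟩ : PBond (F.P P.K) (k P i))) → b₀.src ∈ X P i ∧ b₀.tgt ∈ X P i)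
    {cE cA : B12.RunParams → ℝ}
    (hcE0 : ∀ P : B12.RunParams, 0 ≤ cE P)
    (hcE : ∀ (P : B12.RunParams) (i : ι P), 12 * ((F.P P.K).d : ℝ) * ((n P i : ℝ) + 2) ^ 2 ≤ cE P)
    (hγle : ∀ (P : B12.RunParams) (i : ι P), γ₈ P / (M P i) ^ 5 ≤ 1 / 2 / (2 * (3 * (Kb P i : ℝ) ^ 2 + 2 * (Kb P i : ℝ) ^ 4)))
    (hZblk : ∀ (P : B12.RunParams) (i : ι P), IsBlockUnion (k P i) (Z P i))
    (hB₃ : 0 < B₃)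
    -- [15] THEOREM 1 (8) = (R), GUARD-GENERIC NAMED FACT in K0⁷'s house AT PRINT's CURRENCY `(lamDatum F, dataSmall7LamTopOf F 2)` (`Adm : StepGuard F`; at `Adm := A‴(c,c₀,c₁)` and the
    -- stub's constants = K0⁷'s V23 stub 1ᴮ `K0V23Defs.Prop8StepCoPGridGBAt` through k0-s1-w1's 53′; INHABITED there by `K0Stub1BHolds` ∕ this seat's 112 — at GENERIC constants: displayed)
    (Adm : Node00.StepGuard F) (h15 : VariationalThm1RegSepCoP7MGB F 2 Adm (lamDatum F) (dataSmall7LamTopOf F 2) B₃ a₀ a₁')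
    -- THE GUARD's TWO STRUCTURAL ROWS print's induction (11)–(14) reads: the standing range and stability under truncation (`truncSeq`); at `A‴` both are arithmetic (dag-n12-c ✓p782972)
    (hAdmK : ∀ ν M' g K k' (s : SeqOfRecord F ν M' g K k'), Adm ν M' g K k' s → k' ≤ (F.P K).m + (F.P K).K)
    (hAdmTr : ∀ ν M' g K k' (s : SeqOfRecord F ν M' g K (k' + 1)), 0 < k' → Adm ν M' g K (k' + 1) s → Adm ν M' g K k' (truncSeq s))
    -- THE (J0′) HEAD's SKELETON ROWS AT εreg-BLIND NUMERICS `ν₀` (the head of record ✓p740879 is instantiated at `ν₀`; `Θ.ν` is pinned to `ν₀` off the class threshold below)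
    (ν₀ : Node00.Stage7Numerics)
    (hdiv₀ : ∀ (P : B12.RunParams) (i : ι P), side (F.P P.K).L ν₀.M₁ (k P i) ∣ (F.P P.K).sitesPerDir 0)
    (hfloor₀ : ∀ P : B12.RunParams, ((F.P P.K).d + 14) * (F.P P.K).L ≤ ν₀.M₁)
    (hMrad₀ : ∀ P : B12.RunParams, (4 * (F.P P.K).d + (3 * ((F.P P.K).d * (((F.P P.K).L - 1) / 2)) + 5)) * (F.P P.K).L ^ 2 + 2 * (F.P P.K).d * (F.P P.K).L + 12 ≤ ν₀.M₁)
    (hM₁₀ : ∀ P : B12.RunParams, (((F.P P.K).d + 4) * (F.P P.K).L + 6) * (F.P P.K).L ^ 2 ≤ ν₀.M₁)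
    -- THE GUARD ROW at the head's εreg-blind numerics `ν₀`, per instance, along the degenerate history `(M, g) := (ν₀.M₁, 1)` (β's `hadm`; at `A‴`: `c ≤ ν₀.M₁`, `k P i + c₀ ≤ m + K`, `L^{c₁} ∣ ν₀.M₁`)
    (hadm₀ : ∀ (P : B12.RunParams) (i : ι P) (s₁ : SeqOfRecord F ν₀ ν₀.M₁ (fun _ => (1 : ℝ)) P.K (k P i)), Adm ν₀ ν₀.M₁ (fun _ => (1 : ℝ)) P.K (k P i) s₁)
    -- the BOX SCOPE row of the head (every `k`-bond inside `Z^{(k)}` is a bond of the region box)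
    (hscope : ∀ (P : B12.RunParams) (i : ι P), {e : PBond (F.P P.K) (k P i) | e.src ∈ pts (k P i) (Z P i) ∧ e.tgt ∈ pts (k P i) (Z P i)} ⊆ boxBonds (LO P i) (HI P i))
    -- the analytic family's bound scale (`𝓐₀ P i := 4·𝓐₁`)
    (𝓐₁ : ℝ) (h𝓐₁ : 1 < 𝓐₁)
    -- IN PLACE OF [15] THEOREM 1 (E∕U)'s NAME: THE ONE-LENGTH STEP TOKEN ᴮ at the SAME guard and the SAME constants, print's currency `(lamDatum F, dataSmall7LamTopOf F 2)`, for any ONE `C₁` with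
    -- `2L³ ≤ C₁`, `8L³ < C₁B₃` ([15] Prop. 2 + Sects. B–E at ONE length given `U₀` with (14); «INHABITED BY»: OPEN — N07's obligation; the (E∕U)ᴮ name AT REGULAR-REALISED DATA follows from it
    -- and `h15` by dag-n12-c g38's `variationalThm1EUSepCoP7MGB_realised_of_step_of_reg_lamTop` ✓p782780 — SUPPLY-at-1 ∕ LIFT proved there)
    {C₁ : ℝ} (hC₁ : 2 * (F.L : ℝ) ^ 3 ≤ C₁) (hCB : 8 * (F.L : ℝ) ^ 3 < C₁ * B₃)
    (hstep : VariationalThm1EUStepCoP7MGB F 2 Adm (lamDatum F) (dataSmall7LamTopOf F 2) C₁ B₃ a₀ a₁') :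
    -- THE THREE THRESHOLDS of the (J0′) head, announced from (ν₀, P.K, Z P i, k P i, the two [15] names) BEFORE Θ ∕ the class threshold ∕ the data budget (U4-existential, instance-dependent)
    ∃ ρJ εW δ₀ : ∀ P : B12.RunParams, ι P → ℝ, (∀ P i, 0 < ρJ P i) ∧ (∀ P i, 0 < εW P i) ∧ (∀ P i, 0 < δ₀ P i) ∧
    -- THE NINE LETTER CONSTANTS of the chart half (`C ρ Kτ ρτ ρ5`), the (P4)′ row (`εH B₁`), the small-below ∕ curvature letters (`ρ6 M₂`) — functions of `(P.K, k P)`, from the uniform producers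
    ∃ C ρ Kτ ρτ ρ5 εH B₁ ρ6 M₂ : ∀ P : B12.RunParams, ι P → ℝ, (∀ P i, 0 ≤ C P i) ∧ (∀ P i, 0 < ρ P i) ∧ (∀ P i, 0 ≤ Kτ P i) ∧ (∀ P i, 0 < ρτ P i) ∧ (∀ P i, 0 < ρ5 P i) ∧
      (∀ P i, 0 < εH P i) ∧ (∀ P i, 0 ≤ B₁ P i) ∧ (∀ P i, 0 < ρ6 P i) ∧ (∀ P i, 0 ≤ M₂ P i) ∧
    ∀ (Θ : Stage13Params F 2) (lam : ResidW F 2), { ν₀ with εreg := Θ.ν.εreg } = Θ.ν →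
      (Θ.HasResidualsOfRecord F 2) →
      (∀ P : B12.RunParams, lam.kSel P < P.K → ∀ s, LiveSeq F 2 Θ.ν Θ.τ9 P (gOfRecord₁₃Ax F 2 (Θ.liveRepin₁₃Ax F 2) P) (lam.kSel P + 1)
        (slotsTOfRecord F 2 Θ.ν Θ.τ9 (EOfRecord₁₃Ax F 2 (Θ.liveRepin₁₃Ax F 2)) (wOfRecord₉ F 2 (Θ.liveRepin₁₃Ax F 2).toStage9Params)
          (Θ.liveRepin₁₃Ax F 2).ppSel P (gOfRecord₁₃Ax F 2 (Θ.liveRepin₁₃Ax F 2) P) (lam.kSel P + 1)) s →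
      0 < ∫ V, rterm (reprTOfRecord₁₃Chi F 2 (Θ.liveRepin₁₃Ax F 2) (chiβOfRecord₁₃Ax F 2 Θ) P (lam.kSel P)) s V ∂(fieldMeasure (F.P P.K) (lam.kSel P + 1) (SU 2))) →
      -- THE TERM PINS (167ᴾ ∕ 12P ✓p516715 §1) in place of the free rows at `λ.D1100 ∕ λ.D189`: data `σ sq Nm p₁ Dst`, then 12P §1's rows run by run below the torus
      ∀ (σ : ∀ P : B12.RunParams, Sit189 F 2 P.K),
      ∀ (sq : ∀ P : B12.RunParams, SeqOfRecord F Θ.ν Θ.τ9.M (gOfRecord₁₃Ax F 2 (Θ.liveRepin₁₃Ax F 2) P) P.K (lam.kSel P + 1)),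
      ∀ (Nm : B12.RunParams → ℕ),
      ∀ (p₁ : ℕ),
      (0 < Θ.ν.M₂) →
      (0 < Θ.τ9.M) →
      ∀ (Dst : ∀ P : B12.RunParams, Setting189 (F.P P.K) (SU 2) (MSField (F.P P.K) (SU 2) × ((j : ℕ) → VecField (F.P P.K) j (EuclideanSpace ℝ (Fin (2 ^ 2 - 1))))) (Pt (F.P P.K).d)),
      (∀ P : B12.RunParams, Dst P = ((ResidW.pinRPrime₁₃Ax lam (Θ.liveRepin₁₃Ax F 2)).pinD189ΛH (Θ.liveRepin₁₃Ax F 2).ν (Θ.liveRepin₁₃Ax F 2).A₁ (Θ.liveRepin₁₃Ax F 2).τ9.M (gOfRecord₁₃Ax F 2 (Θ.liveRepin₁₃Ax F 2)) (fun P => (((((σ P).pinZres Θ.ν Θ.τ9.M (gOfRecord₁₃Ax F 2 (Θ.liveRepin₁₃Ax F 2) P) (sq P) (N0OfRecord₁₃Ax (Θ.liveRepin₁₃Ax F 2) P (lam.kSel P + 1))).pinSides Θ.ν (gOfRecord₁₃Ax F 2 (Θ.liveRepin₁₃Ax F 2) P) (lam.kSel P + 1 - Nm P) (lam.kSel P +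 1)).pinXΩ4 (sq P) (enlD F Θ.ν Θ.τ9.M P (gOfRecord₁₃Ax F 2 (Θ.liveRepin₁₃Ax F 2) P))).pinOmegaPP (sq P) (Nm P) (enlD F Θ.ν Θ.τ9.M P (gOfRecord₁₃Ax F 2 (Θ.liveRepin₁₃Ax F 2) P)))) sq Nm p₁).D189 P) →
      (∀ P : B12.RunParams, lam.kSel P < P.K → 1 < (Real.log (gOfRecord₁₃Ax F 2 (Θ.liveRepin₁₃Ax F 2) P (lam.kSel P + 1) ^ 2)⁻¹) ^ Θ.ν.r) →
      (∀ P : B12.RunParams, lam.kSel P < P.K → N0OfRecord₁₃Ax (Θ.liveRepin₁₃Ax F 2) P (lam.kSel P + 1) ≤ Nm P) →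
      (∀ P : B12.RunParams, lam.kSel P < P.K → N0OfRecord₁₃Ax (Θ.liveRepin₁₃Ax F 2) P (lam.kSel P + 1) ≤ lam.kSel P + 1) →
      (∀ P : B12.RunParams, lam.kSel P < P.K → 0 ≤ (σ P).β) →
      (∀ P : B12.RunParams, lam.kSel P < P.K → (σ P).β ≤ 1 / 4) →
      (∀ P : B12.RunParams, lam.kSel P < P.K → 2 ≤ (σ P).L₀) →
      (∀ P : B12.RunParams, lam.kSel P < P.K → (σ P).L₀ ^ 2 ≤ ((F.P P.K).L : ℝ)) →
      (∀ P : B12.RunParams, lam.kSel P < P.K → 0 ≤ (σ P).O1 * (σ P).B₃ * (σ P).B₅) →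
      (∀ P : B12.RunParams, lam.kSel P < P.K → 0 ≤ (σ P).δ) →
      (∀ P : B12.RunParams, lam.kSel P < P.K → (2 + (121 / 120) ^ 2 * ((σ P).O1 * (σ P).B₃ * (σ P).B₅ * (Θ.τ9.M : ℝ) ^ 5)) *
      ((((σ P).L₀ ^ 2) ^ (N0OfRecord₁₃Ax (Θ.liveRepin₁₃Ax F 2) P (lam.kSel P + 1) - 1))⁻¹) ≤ 1 / 4) →
      (∀ P : B12.RunParams, lam.kSel P < P.K → (121 / 120) ^ 2 * ((σ P).O1 * (σ P).B₃ * (σ P).B₅ * (Θ.τ9.M : ℝ) ^ 5) * Real.exp (-(4 * (σ P).δ * (Θ.τ9.M : ℝ))) ≤ 1 / 12) →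
      (∀ P : B12.RunParams, lam.kSel P < P.K → ∀ i, lam.kSel P + 1 - Nm P ≤ i → i ≤ lam.kSel P + 1 → 0 ≤ epsOfRecord Θ.ν (gOfRecord₁₃Ax F 2 (Θ.liveRepin₁₃Ax F 2) P) i) →
      (∀ P : B12.RunParams, lam.kSel P < P.K → ∀ i, lam.kSel P + 1 - Nm P ≤ i → i ≤ lam.kSel P + 1 → epsOfRecord Θ.ν (gOfRecord₁₃Ax F 2 (Θ.liveRepin₁₃Ax F 2) P) i ≤ 1 / 10) →
      ∀ (β₀ : ℝ),
      (0 ≤ β₀) →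
      (β₀ ≤ 1 / 2) →
      (∀ P : B12.RunParams, lam.kSel P < P.K → ∀ j, lam.kSel P + 1 - Nm P ≤ j → j < lam.kSel P + 1 → epsOfRecord Θ.ν (gOfRecord₁₃Ax F 2 (Θ.liveRepin₁₃Ax F 2) P) (lam.kSel P + 1)
      ≤ (1 + β₀) * Real.sqrt ((lam.kSel P + 1 - j : ℕ) : ℝ) * epsOfRecord Θ.ν (gOfRecord₁₃Ax F 2 (Θ.liveRepin₁₃Ax F 2) P) j) →
      ∀ (bβ γβ : ℝ),
      (0 ≤ bβ) →
      (BetaLowerH bβ γβ (betaOfRecord₁₃Ax F 2 (Θ.liveRepin₁₃Ax F 2))) →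
      (γβ ≤ 1) →
      (∀ P : B12.RunParams, lam.kSel P < P.K → Step.InInterval γβ P.K (gOfRecord₁₃Ax F 2 (Θ.liveRepin₁₃Ax F 2) P)) →
      (∀ P : B12.RunParams, lam.kSel P < P.K → (((enlD F Θ.ν Θ.τ9.M P (gOfRecord₁₃Ax F 2 (Θ.liveRepin₁₃Ax F 2) P)) 4 (lam.kSel P + 1 + 1 - (N0OfRecord₁₃Ax (Θ.liveRepin₁₃Ax F 2) P (lam.kSel P + 1)))
        (omegaOfChain (sq P) (lam.kSel P + 1 + 1 - (N0OfRecord₁₃Ax (Θ.liveRepin₁₃Ax F 2) P (lam.kSel P + 1)))))ᶜ ∩ (σ P).Z).Nonempty) →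
      (∀ P : B12.RunParams, lam.kSel P < P.K → ∀ U, new189 (Dst P) U → ∀ p ∈ plaqsOf (half (Dst P)),
      Ineq191 (dist1 (plaqHol ((Dst P).Upp U) p)) ((Dst P).devV'' U p) (Dst P).α (((Dst P).L ^ (Dst P).h)⁻¹) ((Dst P).ε (Dst P).h) (E124 (Dst P).ε (Dst P).L (Dst P).η (Dst P).k (Dst P).h)) →
      (∀ P : B12.RunParams, lam.kSel P < P.K → ∀ U, new189 (Dst P) U → ∀ p ∈ plaqsOf (half (Dst P)),
      Ineq195 ((Dst P).devV'' U p) (dist1 (plaqHol ((Dst P).Uhalf U ((Dst P).boxOf p)) p)) (Dst P).α (((Dst P).L ^ (Dst P).h)⁻¹) ((Dst P).ε (Dst P).h) (E124 (Dst P).ε (Dst P).L (Dst P).η (Dst P).k (Dst P).h)) →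
      (∀ P : B12.RunParams, lam.kSel P < P.K → ∀ U, new189 (Dst P) U → ∀ j, (Dst P).h ≤ j → j ≤ (Dst P).k → ∀ p ∈ plaqsOf (dom (Dst P) j),
      Ineq191 (dist1 (plaqHol ((Dst P).Upp U) p)) ((Dst P).dev97 U p) (Dst P).α (((Dst P).L ^ j)⁻¹) ((Dst P).ε j) (E124 (Dst P).ε (Dst P).L (Dst P).η (Dst P).k j)) →
      (∀ P : B12.RunParams, lam.kSel P < P.K → ∀ U, new189 (Dst P) U → ∀ j, (Dst P).h ≤ j → j ≤ (Dst P).k → ∀ p ∈ plaqsOf (dom (Dst P) j),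
      Ineq191 ((Dst P).dev97 U p) ((Dst P).dev0 U p) (Dst P).α (((Dst P).L ^ j)⁻¹) ((Dst P).ε j) (E124 (Dst P).ε (Dst P).L (Dst P).η (Dst P).k j)) →
      (∀ P : B12.RunParams, lam.kSel P < P.K → ∀ U, new189 (Dst P) U → ∀ j, (Dst P).h ≤ j → j ≤ (Dst P).k → ∀ p ∈ plaqsOf (dom (Dst P) j),
      Ineq180 ((Dst P).dev0 U p) ((Dst P).ε (Dst P).k) (Dst P).η (Dst P).B₃ (Dst P).B₅ (Dst P).M (Dst P).δ ((Dst P).dist p) (Dst P).O1) →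
      (∀ (P : B12.RunParams) (i : ι P), ∀ (ν' : Fin (F.P P.K).d), ∀ z ∈ box (fun κ => (hi P i κ - lo P i κ + 1).toNat + 3) (fun κ => lo P i κ - 2),
      (castSite z : Site (F.P P.K) (k P i)) ∈ pts (k P i) (maxDomT Θ.ν.M₁ (Z P i) (k P i)) ∧
        (castSite z : Site (F.P P.K) (k P i)).shift ⟨0, h0 P⟩ ∈ pts (k P i) (maxDomT Θ.ν.M₁ (Z P i) (k P i)) ∧
        (castSite z : Site (F.P P.K) (k P i)).shift ν' ∈ pts (k P i) (maxDomT Θ.ν.M₁ (Z P i) (k P i))) →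
      (∀ P : B12.RunParams, (143 * (((((F.P P.K).d + 4 : ℕ) : ℝ)) ^ 2 / 4) ^ 2) * (Θ.ν.εreg * (F.P P.K).L ^ 2) ≤ 1 / 3) →
      (∀ P : B12.RunParams, 2 * (Θ.ν.εreg * (F.P P.K).L ^ 2) ≤ 2 * deltaSU (Fin 2) / ((((F.P P.K).d + 4) * (F.P P.K).L : ℕ) : ℝ) ^ 2) →
      (∀ P : B12.RunParams, (((((F.P P.K).d + 2) * (F.P P.K).L : ℕ) : ℝ) ^ 2 / 4) * (2 * (Θ.ν.εreg * (F.P P.K).L ^ 2)) < deltaSU (Fin 2)) →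
      (∀ (P : B12.RunParams) (i : ι P), ∀ x ∈ X P i, ∃ x₀ ∈ maxDomT Θ.ν.M₁ (Z P i) (k P i), ∃ w₀ : List (Letter (F.P P.K).d), w₀.length ≤ D₀ P i ∧ walkEnd x₀ w₀ = x) →
      (∀ (P : B12.RunParams) (i : ι P), D₀ P i + 3 * (∑ i' ∈ Finset.range (k P i + 1), ((F.P P.K).d * (((F.P P.K).L ^ i' - 1) / 2) + 1)) + ((3 * ((F.P P.K).d * (((F.P P.K).L - 1) / 2)) + 5) + 5) * (F.P P.K).L ^ k P i +
      (((F.P P.K).d + 4) * (F.P P.K).L + 2) * (∑ l ∈ Finset.Ico 0 (k P i), (F.P P.K).L ^ l) + 4 ≤ (F.P P.K).L ^ (k P i - 1) * Θ.ν.M₁) →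
      (∀ P : B12.RunParams, 4 * (F.P P.K).L ≤ Θ.ν.M₁) →
      (∀ (P : B12.RunParams) (i : ι P) (y : Site (F.P P.K) 0), B14.Eq22Determines.blockIter (k P i) y ∈ (castSite '' Set.Icc (lo P i - 1) (hi P i + 1) : Set (Site (F.P P.K) (k P i))) → y ∈ maxDomT Θ.ν.M₁ (Z P i) 1) →
      (∀ (P : B12.RunParams) (i : ι P), side (F.P P.K).L Θ.ν.M₁ (k P i) ∣ (F.P P.K).sitesPerDir 0) →
      (∀ (P : B12.RunParams) (i : ι P), 1 / 2 * (B₃ * (cE P + 1) * (F.P P.K).eta 1 ^ 2) ^ 2 * (Nat.card {q : Plaq (F.P P.K) 0 // q ∈ plaqsOf (maxDomT Θ.ν.M₁ (Z P i) 1)} : ℝ) ≤ cA P) →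
      (2 ≤ Θ.ν.M₁) →
      (0 < Θ.ν.εreg) →
      (Θ.ν.εreg ≤ a₀) →
      -- THE GUARD CAP `eG` and the cap-level datum tolerance `ρnG` with the head's rows at the cap (all upper bounds on `eG`, `ρnG`, `Θ.ν.εreg`)
      ∀ (eG ρnG : ∀ P : B12.RunParams, ι P → ℝ), (∀ (P : B12.RunParams) (i : ι P), 0 < eG P i) →
      (∀ (P : B12.RunParams) (i : ι P), 6 * ((((F.P P.K).d - 1 : ℕ)) : ℝ) * (F.P P.K).L ^ (k P i) * (2 * ((cE P + 1) * eG P i)) ≤ ρJ P i) →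
      (∀ (P : B12.RunParams) (i : ι P), 12 * ((((F.P P.K).d - 1 : ℕ)) : ℝ) * (F.P P.K).L * Θ.ν.εreg ≤ ρJ P i) →
      (∀ (P : B12.RunParams) (i : ι P), Θ.ν.εreg ≤ εW P i) →
      (∀ P : B12.RunParams, (143 * (((((F.P P.K).d + 4 : ℕ) : ℝ)) ^ 2 / 4) ^ 2) * (2 * ((F.P P.K).L : ℝ) ^ 2 * Θ.ν.εreg) ≤ 1 / 3) →
      (∀ P : B12.RunParams, 2 * (2 * ((F.P P.K).L : ℝ) ^ 2 * Θ.ν.εreg) ≤ 2 * deltaSU (Fin 2) / ((((F.P P.K).d + 4) * (F.P P.K).L : ℕ) : ℝ) ^ 2) →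
      (∀ (P : B12.RunParams) (i : ι P), (cE P + 1) * (2 * eG P i) ≤ a₁' ∧ B₃ * ((cE P + 1) * (2 * eG P i)) ≤ Θ.ν.εreg) →
      (Θ.ν.εreg < a₀) →
      (∀ (P : B12.RunParams) (i : ι P), 0 ≤ ρnG P i) →
      (∀ (P : B12.RunParams) (i : ι P), max (ρnG P i) ((((2 * (∑ i' ∈ Finset.range (k P i + 1), ((F.P P.K).d * (((F.P P.K).L ^ i' - 1) / 2) + 1)) + 1 +
                  (3 * ((F.P P.K).d * (((F.P P.K).L - 1) / 2)) + 5) * (F.P P.K).L ^ (k P i) : ℕ) : ℝ)) ^ 2 / 4 * (Θ.ν.εreg * (F.P P.K).eta 0 ^ 2) +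
                ((3 * ((F.P P.K).d * (((F.P P.K).L - 1) / 2)) + 5 : ℕ) : ℝ) * (6 * ((((((F.P P.K).d + 2) * (F.P P.K).L : ℕ) : ℝ) ^ 2 / 4) * (2 * (Θ.ν.εreg * (F.P P.K).L ^ 2))) * ∑ i' ∈ Finset.range (k P i), ((F.P P.K).L : ℝ) ^ i') + ((3 * ((F.P P.K).d * (((F.P P.K).L - 1) / 2)) + 5 : ℕ) : ℝ) * ρnG P i) ≤ δ₀ P i) →
      (∀ (P : B12.RunParams) (i : ι P), (((F.P P.K).d : ℝ) * n' P i + 1) * ((((F.P P.K).d - 1 : ℕ) : ℝ) * n' P i * ((12 * (F.P P.K).d * (n P i + 2) ^ 2 + 1) * eG P i) + 3 * (F.P P.K).d * (n P i + 2) ^ 2 * eG P i) ≤ ρnG P i) →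
      -- THE (J0′) RADIUS, announced BEFORE the data budget `eR`
      ∃ R : ∀ P : B12.RunParams, ι P → ℝ, (∀ P i, 0 < R P i) ∧
      ∀ (eR : ∀ P : B12.RunParams, ι P → ℝ), (∀ (P : B12.RunParams) (i : ι P), 0 < eR P i) → (∀ (P : B12.RunParams) (i : ι P), eR P i ≤ eG P i) →
      ∀ (ρn : ∀ P : B12.RunParams, ι P → ℝ),
      (∀ (P : B12.RunParams) (i : ι P), (((F.P P.K).d : ℝ) * n' P i + 1) * ((((F.P P.K).d - 1 : ℕ) : ℝ) * n' P i * ((12 * (F.P P.K).d * (n P i + 2) ^ 2 + 1) * eR P i)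
      + 3 * (F.P P.K).d * (n P i + 2) ^ 2 * eR P i) ≤ ρn P i) →
      ∀ (cJ : B12.RunParams → ℝ), (∀ P : B12.RunParams, 0 ≤ cJ P) →
      (∀ (P : B12.RunParams) (i : ι P), (cE P + 1) * (2 * eR P i) ≤ a₁' ∧ B₃ * ((cE P + 1) * (2 * eR P i)) ≤ Θ.ν.εreg) →
      (∀ (P : B12.RunParams) (i : ι P), 6 * ((((F.P P.K).d - 1 : ℕ)) : ℝ) * (F.P P.K).L * (2 * B₃ * (cE P + 1) * eR P i) ≤ ρ5 P i) →
      (∀ (P : B12.RunParams) (i : ι P), 6 * ((((F.P P.K).d - 1 : ℕ)) : ℝ) * (F.P P.K).L * (2 * B₃ * (cE P + 1) * eR P i) ≤ ρ6 P i) →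
      (∀ (P : B12.RunParams) (i : ι P), 2 * cA P * eR P i / R P i + 2 * ((Nat.card {q : Plaq (F.P P.K) 0 // q ∈ plaqsOf (maxDomT Θ.ν.M₁ (Z P i) 1)} : ℝ) * (1 + 8 * (4 * 𝓐₁) ^ 4)) / (R P i * eR P i) ≤ cJ P) →

    ∀ δ : ∀ P : B12.RunParams, ι P → ℝ, (∀ P i, 0 < δ P i) →
      -- the endpoint's EXPLICIT THRESHOLD per run (every quantity a displayed binder or a count of the run's instance — no `∃ δ₀`), then its TOLERANCE rows at `δ P i`
      (∀ (P : B12.RunParams) (i : ι P), δ P i ≤ min (min (min (ρ P i) (ρτ P i) / 2)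
        (min 1 (1 / 2 / (2 * (3 * (Kb P i : ℝ) ^ 2 + 2 * (Kb P i : ℝ) ^ 4)) /
          (max ((32 * (((F.P P.K).d : ℝ) - 1) + 8 * (((F.P P.K).d : ℝ) - 1) + (2 * (((F.P P.K).d : ℝ) - 1) * B₁ P i * (((∑ j ∈ Finset.range (k P i + 1), (2 * (F.P P.K).d) ^ j : ℕ) : ℝ) * M₂ P i))) * (12 * (4 * 𝓐₁) / R P i * Real.sqrt (Nat.card {b : PBond (F.P P.K) 0 // b ∈ {b : PBond (F.P P.K) 0 | b.src ∈ maxDomT Θ.ν.M₁ (Z P i) 1 ∨ b.tgt ∈ maxDomT Θ.ν.M₁ (Z P i) 1}})) ^ 2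
            + (8 * (((F.P P.K).d : ℝ) + 1) * (2 * (Kτ P i + 1)) + 8 * ((F.P P.K).d : ℝ) * (((box (fun κ => (hi P i κ - lo P i κ + 1).toNat + 3) (fun κ => lo P i κ - 2)).image (fun z => (castSite z : Site (F.P P.K) (k P i)))).card : ℝ) * (C P i * (12 * (4 * 𝓐₁) / R P i * Real.sqrt (Nat.card {b : PBond (F.P P.K) 0 // b ∈ {b : PBond (F.P P.K) 0 | b.src ∈ maxDomT Θ.ν.M₁ (Z P i) 1 ∨ b.tgt ∈ maxDomT Θ.ν.M₁ (Z P i) 1}}))) ^ 2)) 0 + 1)))) (εH P i)) →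
      ∀ (hfloor : ∀ (P : B12.RunParams) (i : ι P), ((((4 * (F.P P.K).d + (3 * ((F.P P.K).d * (((F.P P.K).L - 1) / 2)) + 5) + 3 : ℕ) : ℝ)) ^ 2 * ((F.P P.K).L : ℝ) ^ 2 / 4 + ((3 * ((F.P P.K).d * (((F.P P.K).L - 1) / 2)) + 5 : ℕ) : ℝ) * (24 * (((((F.P P.K).d + 2) * (F.P P.K).L : ℕ) : ℝ) ^ 2 / 4))) * (2 * B₃ * (cE P + 1) * eR P i) + ((3 * ((F.P P.K).d * (((F.P P.K).L - 1) / 2)) + 5 : ℕ) : ℝ) * ρn P i ≤ δ P i),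
      ∃ areg : ∀ P : B12.RunParams, ι P → ℝ, (∀ P i, 0 < areg P i) ∧
        ∀ P : B12.RunParams, lam.kSel P < P.K →
          B15Leaf (WOfRecord₁₃Ax F 2 (Θ.liveRepin₁₃Ax F 2)
            ((ResidW.pinRPrime₁₃Ax { lam with LF := fun P => lfVarOn su2Chart fun i => InstOn.stdB (Node00.bgMSCoPOfRecordB F 2 Θ.ν P.K (k P i) (maxDomT Θ.ν.M₁ (Z P i))) Θ.ν.M₁ lamDatumP (Z P i) (Λ P i) (k P i) (M P i) (areg P i) (anExt (pts (k P i) (Λ P i)) (T P i) (fun177stdB (Node00.bgMSCoPOfRecordB F 2 Θ.ν P.K (k P i) (maxDomT Θ.ν.M₁ (Z P i))) Θ.ν.M₁ lamDatumP (Z P i) (k P i)) (ext P i) (min (1 / 2) (min (R P i / 8) (γ₈ P / (M P i) ^ 5 * (R P i / 2) ^ 2 / (48 * (4 * ((Nat.card {q : Plaq (F.P P.K) 0 // q ∈ plaqsOf (maxDomT Θ.ν.M₁ (Z P i) 1)} : ℝ) * (1 + 8 * (4 * 𝓐₁) ^ 4)) / R P i + 1)))))) } (Θ.liveRepin₁₃Ax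 F 2)).pinD189ΛH (Θ.liveRepin₁₃Ax F 2).ν (Θ.liveRepin₁₃Ax F 2).A₁ (Θ.liveRepin₁₃Ax F 2).τ9.M (gOfRecord₁₃Ax F 2 (Θ.liveRepin₁₃Ax F 2)) (fun P => (((((σ P).pinZres Θ.ν Θ.τ9.M (gOfRecord₁₃Ax F 2 (Θ.liveRepin₁₃Ax F 2) P) (sq P) (N0OfRecord₁₃Ax (Θ.liveRepin₁₃Ax F 2) P (lam.kSel P + 1))).pinSides Θ.ν (gOfRecord₁₃Ax F 2 (Θ.liveRepin₁₃Ax F 2) P) (lam.kSel P + 1 - Nm P) (lam.kSel P + 1)).pinXΩ4 (sq P) (enlD F Θ.ν Θ.τ9.M P (gOfRecord₁₃Ax F 2 (Θ.liveRepin₁₃Ax F 2) P))).pinOmegaPP (sq P) (Nm P) (enlD F Θ.ν Θ.τ9.M P (gOfRecord₁₃Ax F 2 (Θ.liveRepin₁₃Ax F 2) P)))) sq Nm p₁) P) := by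
  obtain ⟨ρJ, εW, δ₀, hρJ, hεW, hδ₀, C, ρ, Kτ, ρτ, ρ5, εH, B₁, ρ6, M₂, hC, hρ, hKτ, hρτ, hρ5, hεH, hB1, hρ6, hM₂0, hmain⟩ :=
    exists_constants_thresholds_radius_areg_pinLF_b15Leaf_WOfRecord₁₃_pinAllΛΩχZ_N0_liveRepin₁₃_windowDirectDatumScale_lettersDischargedAtLength_termPinned_ofRegNameGB_ofStepGB
      hd3 h0 ι Z Λ k M hk0 hk1 T lo hi n hn hN hbox hZ hTG0 hN5 Kb hK1 hKn ext hext hlohi LO HI hLO hHI n' hn' hn'N hR' hγ hbx hbxM hM W hWbox c hkc hc X D₀ hBox hWX hfeedsX hcE0 hcE hγle hZblk hB₃ Adm h15 hAdmK hAdmTr ν₀ hdiv₀ hfloor₀ hMrad₀ hM₁₀ hadm₀ hscope 𝓐₁ h𝓐₁ hC₁ hCB hstep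
  exact ⟨ρJ, εW, δ₀, hρJ, hεW, hδ₀, C, ρ, Kτ, ρτ, ρ5, εH, B₁, ρ6, M₂, hC, hρ, hKτ, hρτ, hρ5, hεH, hB1, hρ6, hM₂0,
    fun Θ lam => hmain Θ (chiβOfRecord₁₃Ax F 2 Θ) lam⟩

end

end Summit.QuantumFields.YangMills.BalabanUVNodes.N12AtRecord13Prop1KnitThm1WindowDirectDatumScaleLettersDischargedAtLengthOfRegNameAndStepOfRecordTermPinnedAx

end
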